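import Literature.MathematicalPhysics.QuantumFieldTheory.Balaban1983to89.B6CubePairOutDecayV1
import Literature.MathematicalPhysics.QuantumFieldTheory.Balaban1983to89.B6GDVaLegKLevelV1
import Literature.MathematicalPhysics.QuantumFieldTheory.Balaban1983to89.B6Prop26KLevelSkeletonV2

/-!
# `Balaban1983to89.B6HolderDivLegPairTermsV1` — T. Bałaban, *Propagators and renormalization transformations for lattice gauge theories. II*,
# Commun. Math. Phys. **96** (1984) 223–250 [Balaban1984PropagatorsII], Prop. 2.6 (2.137) p. 247 (second member `‖ζG∇*J‖_α`) with (2.141) p. 247,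
# (2.133)–(2.134) p. 247 and (2.92) p. 239: THE CUBE LEGS OF THE TWO-SIDED WALK BEHIND THE PAIR-DIFFERENCE OPERATOR, PER CUBE, FOR A GLOBAL PAIR
# `(x, x′)`, FROM DISPLAYED PAIR INPUTS — the left factor `P_{x,x′}·h_□G_□` (global majorant), its `2(d+1)` right legs `P_{x,x′}·h_□G_□·E_e` (global
# majorants), its output localisation in `□̃`, and the first leg `P_{x,x′}·(h_□G_□h_□)·∇*_ν` — by the product rule at two points
# `P_{x,x′}·M_h = h(x′)P_{x,x′} + (h(x) − h(x′))M_{1_x}` read against OUTPUT-localised pair and single-point majorants (inputs anywhere)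

statement-level skeleton of published theorems with citation tags; proofs where landed; nothing here is a claim about the Yang–Mills mass gap

PDF held: `paper:balaban1984-cmp96-propagators-rt-ii` (journal page = PDF page + 222), p. 247 [PDF 25] (×2 render re-read this generation):
*"‖ζ∇GJ‖_α, ‖ζG∇*J‖_α ≤ O(1)(Lʲη)^{1−α}(‖ζ‖^ξ_α + |ζ|)e^{−δ₃d(y,y′)}|J|, ξ = L^{−j} (2.137) for 0 ≤ α < 1, ζ ∈ C₀^∞(Δ̃(y)) …, supp J ⊂ Δ(y′), with
the constant O(1) depending on d, L and α"*; *"G = … = Σ_ω h_{□₀}G_{□₀}h_{□₀}K_{□₁,□₂}G_{□₂}h_{□₂}… (2.141) and the series above is convergent in the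
norms appearing in the inequalities (2.136)–(2.140)"*; p. 239 [PDF 17] (2.92) line 1 (the commutator of `Δ` with `h_□`); [4] (1.109) p. 35 (the Hölder
quotient at one pair).

CITATION HEADER (lean-in-tree rule) — WHAT IS REPRODUCED.  Phase-2 file of the `lit-balaban` typed skeleton (HOME `run/shared/lean/pub/lit-balaban/`),
seat **p38 gen 32** (free target (2.137)₂ at k levels, protocol G.5-34(d), TAKING HOME/STATUS.md 2026-08-23T22:54Z); SKELETON rows **B6.Prop2.6** ×
B6.Eq2.141 × B6.Eq2.133 (cells only; decls of record untouched).  THE READING (ours, HOME/GAPS.md G-B6-2137-2): one step of the transposed walk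
`P·G·∇* = P·G₀·∇* + (P·R̃)·(G·∇*)` (`…B6Prop26PairMirrorAssemblyV1.prop26_pairT_kLevel_final_le`) consumes, per cube `□` and for the left factor
`P = P_{x,x′}`: (L1) a GLOBAL majorant of `P·h_□G_□`, (L2) GLOBAL majorants of `P·h_□G_□·E_e` for all `2(d+1)` legs `e`, (L3) `OutLoc (P·h_□G_□) □̃`,
(F1) the first leg `P·(h_□G_□h_□)·∇*_ν` with the output indicator `1_{□̃}`.  THIS FILE derives (L1)–(L3), (F1) for a GLOBAL pair `(x, x′)` from
DISPLAYED output-localised PAIR INPUTS `OutMajorant (P_{x,x′}·G_□) (□⁺) (τ·pref·e^{−ρ′d})`, `OutMajorant (P_{x,x′}·(G_□·E_e)) (□⁺) (τ_e·pref·e^{−ρ′d})`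
required only when `h_□(x) ≠ 0` or `h_□(x′) ≠ 0` (instantiated by this seat's `…B6CubePairOutDecayV1.hHGout_cube` / `hHGEout_cube` once the pair is placed in the
cube's chart frame — p22 g26's `…B6HolderPairWindowV1.pair_window`), a DISPLAYED size `|h_□(x) − h_□(x′)| ≤ σ_h` (p22's
`…B6HBDisplacementLipV1.abs_hB_sub_le_supDist` once landed) and the DISPLAYED PLACEMENT `h_□(x′) ≠ 0 ⇒ y(x) ∈ □⁺` (for near pairs `|x − x′|_∞ ≤ L^{j₀+1}`:
`supp h_□ ⊂ {dist < S}`, the pair adds `≤ S/8`, the block radius `≤ S/16`, `□⁺ = {centre ≤ 5S/4}` — the sequel).  NO comparison of the two output blocks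
is needed: `h(x)T(x) − h(x′)T(x′) = h(x′)(T(x) − T(x′)) + (h(x) − h(x′))T(x)` is read ENTIRELY at `y(x) ∈ □⁺`.  (The modular shape parallels p22 g26's
`…B6HolderLegPairTermsV1.holderLeg_pair_of_inputs` for the (2.137)₁ lane.)  Contents:
* §1 (generic lattices) **`outMajorant_mul_mulOp_bdd`** (a bounded right multiplier under an output-localised majorant), **`hasMajorant_pair_mulOp_of_out`**
  — THE PRODUCT RULE AT TWO POINTS AGAINST OUTPUT-LOCALISED MAJORANTS: `P_{x,x′}·M_h·T` has the global majorant `1_S(y)·(K + σ_h·K₁)` from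
  `OutMajorant (P_{x,x′}·T) S K` (when `h(x) ≠ 0 ∨ h(x′) ≠ 0`), `OutMajorant T S K₁`, `supp h ⊂ S`, `|h| ≤ 1`, `|h(x) − h(x′)| ≤ σ_h` and the placement
  `h(x′) ≠ 0 ⇒ y(x) ∈ S`; **`outLoc_pair_mulOp`** (+ private `outLoc_mono`);
* §2 (the V1 torus, per cube, global pair) **`legHG_pair_of_inputs`** (L1): `HasMajorant (P_{x,x′}·h_□G_□) ((τ + σ_h·C₀)·pref·e^{−min(ρ₀,ρ′)d_T})`;
  **`legHGE_pair_of_inputs`** (L2): the same for `P_{x,x′}·h_□G_□·E_e` from `τ_e`; **`outLoc_pairLeg`** (L3); **`firstLegDiv_pair_of_inputs`** (F1):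
  `HasMajorant (P_{x,x′}·(h_□G_□h_□)·∇*_ν) (1_{□⁺}(y)·L²(τ_{(ν,−)} + C1F·τ + σ_h·C₀)·(L^{j(y)}|c′|⁻¹)·e^{−min(ρ₀,ρ′)d_T})` (p38's `GDVa_sandwich_eq` + the
  sizes of `S_νh_□`, `∇_νh_□`) — print's `O(1)(Lʲη)^{1−α}|x − x′|^α e^{−δd}|J|` for the first leg once `τ_e = C_H t^α`, `τ = C_H t`, `σ_h = C t`.
IMPORTS BY NAME, restating nothing; THEOREMS ONLY (no `def`, no `def … : Prop`, no new hypothesis); standard axioms.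

HONEST SCOPE / DIVERGENCES.  (1) Print proves (2.137) by *"Reasoning in the same way as in the proof of Proposition 2.2"* (p. 247); the two-sided walk
and the output-localised bookkeeping are OURS (G-B6-2137-2); no mathematical gap in the source is claimed.  (2) The pair inputs, the size `σ_h` and the
placement are DISPLAYED hypotheses here (discharged for near admissible pairs by the window geometry in the sequel — p22's `pair_window`, this seat's
placement lemma and assembly `…B6Prop26HolderDivKLevelV1`); for a pair inside ONE block the placement is `supp h_□ ⊂ □⁺` itself.  (3) As the imported cube files:
`L ≥ 5`, `M_h = Lᵃ ≥ 8`, `R ≥ 2L²`, `P′ ≥ 5`, placed cube; constants on `d, L` and the weight band, not optimised.  Integer tori, lattice units; nothing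
on d = 4 specifically or the continuum; NOT summit progress.  Unit `lit-balaban-p38` (gen 32), 2026-08-24.
-/

noncomputable section

open scoped BigOperators
open Finset

namespace Literature.MathematicalPhysics.QuantumFieldTheory.Balaban1983to89.B6HolderDivLegPairTermsV1

open LatticeFieldCalculus
open B4Reflection242 (boxDom)
open B6MultiLevelBoxOperator (N0 bigSide one_le_bigSide)
open B6MultiLevelTorusOperator (TDomains)
open B6Eq238MultiLevelTorus (svec)
open B6Cover236MultiLevelBlocks (cubes)
open B6Geom246MultiLevelBox (bset)
open B6Geom246MultiLevelTorus (geomT triangle_refl_nonneg_T)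
open B8Ineq192MultiLevelTorus (geomT_len)
open B6Partition118KLevelTorusCentral (one_le_of_four_le)
open B6Partition118KLevelFineSizes (C1F C1F_nonneg)
open B6GlobalChartV1 (PV toBox blkV1 domT)
open B6SectAOperatorsV1 (BondIdx)
open B6RandomWalk (HasMajorant hasMajorant_mono hasMajorant_add BlockSupp)
open B6Prop26Gluing (mulOp mulOp_apply OutLoc ind ind_nonneg ind_le_one ind_of_mem ind_of_not_mem)
open B6Prop26KLevelSkeletonV1 (hB ST mem_ST pref pref_nonneg abs_hB_le_one blkV1_mem_QT_of_hB_ne_zero)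
open B6Prop26KLevelSkeletonV2 (SbigT ST_subset_SbigT)
open B6Prop26KLevelAssemblyV1 (hasMajorant_smul)
open B6InDecayWindowV1 (OutMajorant outMajorant_mono)
open B6CubeWindowV1 (x0 j0 Placed Gl j0_le_level)
open B6Eq292MemberTorusV1 (EC)
open B6CubeRightLegsV1 (hGout_cube)
open B6GradLegKLevelV1 (shB shB_apply DV DV_apply abs_DV_apply blkV1_mem_ST_of_hB_shift_ne_zero abs_hB_shift_sub_le pref_scale_le lip_scale_le)
open B6GDVaLegKLevelV1 (GDVa_sandwich_eq)
open B6LapLegKLevelV1 (DVa)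
open B6HolderPairMemberV1 (pairOp pairOp_mul_apply)
open B6CubePairOutDecayV1 (hGEout_cube)

/-! ## §1  Generic: a bounded right multiplier; the product rule at two points against output-localised majorants -/

section Generic

variable {g : B6.Geometry} {X : Type}

/-- **A BOUNDED RIGHT MULTIPLIER UNDER AN OUTPUT-LOCALISED MAJORANT**: `OutMajorant T S K` and `|f| ≤ t` (`t ≥ 0`) give `OutMajorant (T·M_f) S (t·K)`
(`M_fμ` is block-supported where `μ` is, with bound `t·B`). [cite: Balaban1984PropagatorsII, (2.51) p.232, (2.92) p.239 (the right factors h_□, ∂h_□); bookkeeping ours] -/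
theorem outMajorant_mul_mulOp_bdd (blk : X → g.Site) {T : Module.End ℝ (X → ℝ)} {S : Set g.Site} {K : g.Site → g.Site → ℝ}
    (h : OutMajorant blk T S K) {f : X → ℝ} {t : ℝ} (ht : 0 ≤ t) (hf : ∀ z, |f z| ≤ t) :
    OutMajorant blk (T * mulOp f) S (fun a b => t * K a b) := by
  intro y' μ B hμ z hz
  have hfμ : BlockSupp blk (mulOp f μ) y' (t * B) := by
    refine ⟨mul_nonneg ht hμ.nonneg, fun x' hx' => ?_, fun x' hx' => ?_⟩
    · rw [mulOp_apply, abs_mul]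
      exact mul_le_mul (hf x') (hμ.bound x' hx') (abs_nonneg _) ht
    · rw [mulOp_apply, hμ.off x' hx', mul_zero]
  rw [Module.End.mul_apply]
  calc |T (mulOp f μ) z| ≤ K (blk z) y' * (t * B) := h y' (mulOp f μ) (t * B) hfμ z hz
    _ = t * K (blk z) y' * B := by ring

variable [DecidableEq X]

/-- **THE PRODUCT RULE AT TWO POINTS AGAINST OUTPUT-LOCALISED MAJORANTS.**  For the pair-difference operator `P_{x,x′}`, a multiplier `h` supported over
the blocks of `S` with `|h| ≤ 1` and `|h(x) − h(x′)| ≤ σ_h`, an operator `T` with single-point majorant `OutMajorant T S K₁` (inputs anywhere) and — when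
`h(x) ≠ 0` or `h(x′) ≠ 0` — the output-localised PAIR majorant `OutMajorant (P_{x,x′}·T) S K`, and the PLACEMENT `h(x′) ≠ 0 ⇒ y(x) ∈ S`:
`HasMajorant (P_{x,x′}·M_h·T) (1_S(y)·(K + σ_h·K₁))` — `h(x)T(x) − h(x′)T(x′) = h(x′)(T(x) − T(x′)) + (h(x) − h(x′))T(x)`, read entirely at `y(x) ∈ S`
(no comparison of the two output blocks is needed).
[cite: Balaban1984PropagatorsII, (2.137) p.247 (the factor (‖ζ‖_α + |ζ|)), (2.141) p.247; Balaban1984PropagatorsI, (1.109) p.35; bookkeeping ours] -/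
theorem hasMajorant_pair_mulOp_of_out (blk : X → g.Site) (x x' : X) {T : Module.End ℝ (X → ℝ)} {h : X → ℝ} {S : Set g.Site}
    {K K₁ : g.Site → g.Site → ℝ} {sH : ℝ} (hK : ∀ a b, 0 ≤ K a b) (hK₁ : ∀ a b, 0 ≤ K₁ a b) (hsH : 0 ≤ sH)
    (hpair : h x ≠ 0 ∨ h x' ≠ 0 → OutMajorant blk (pairOp x x' * T) S K) (hout : OutMajorant blk T S K₁)
    (hsupp : ∀ z, h z ≠ 0 → blk z ∈ S) (hle : ∀ z, |h z| ≤ 1) (hLip : |h x - h x'| ≤ sH) (hplace : h x' ≠ 0 → blk x ∈ S) :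
    HasMajorant blk (pairOp x x' * mulOp h * T) (fun a b => ind S a * (K a b + sH * K₁ a b)) := by
  intro y' μ B hμ z
  have hnn : ∀ a, 0 ≤ ind S a * (K a y' + sH * K₁ a y') * B := fun a => by
    have := hK a y'; have := hK₁ a y'; have := ind_nonneg S a; have := hμ.nonneg
    positivity
  rw [mul_assoc, pairOp_mul_apply]
  by_cases hz : z = x
  · rw [if_pos hz, hz]
    simp only [Module.End.mul_apply, mulOp_apply]
    by_cases hne : h x ≠ 0 ∨ h x' ≠ 0
    · -- `y(x) ∈ S`: the product rule at two points, read at `y(x)`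
      have hxS : blk x ∈ S := hne.elim (hsupp x) hplace
      have hp : |T μ x - T μ x'| ≤ K (blk x) y' * B := by
        have := hpair hne y' μ B hμ x hxS
        rwa [pairOp_mul_apply, if_pos rfl] at this
      have hs : |T μ x| ≤ K₁ (blk x) y' * B := hout y' μ B hμ x hxS
      have e : h x * T μ x - h x' * T μ x' = h x' * (T μ x - T μ x') + (h x - h x') * T μ x := by ring
      rw [e]
      calc |h x' * (T μ x - T μ x') + (h x - h x') * T μ x|
          ≤ |h x'| * |T μ x - T μ x'| + |h x - h x'| * |T μ x| := by
            refine (abs_add_le _ _).trans ?_; rw [abs_mul, abs_mul]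
        _ ≤ 1 * (K (blk x) y' * B) + sH * (K₁ (blk x) y' * B) :=
            add_le_add (mul_le_mul (hle x') hp (abs_nonneg _) zero_le_one) (mul_le_mul hLip hs (abs_nonneg _) hsH)
        _ = ind S (blk x) * (K (blk x) y' + sH * K₁ (blk x) y') * B := by rw [ind_of_mem hxS]; ring
    · -- `h(x) = h(x′) = 0`: the entry vanishes
      have hx0 : h x = 0 := by
        by_contra h0
        exact hne (Or.inl h0)
      have hx'0 : h x' = 0 := by
        by_contra h0
        exact hne (Or.inr h0)
      rw [hx0, hx'0, zero_mul, zero_mul, sub_zero, abs_zero]; exact hnn (blk x)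
  · rw [if_neg hz, abs_zero]; exact hnn (blk z)

/-- **OUTPUT LOCALISATION OF `P_{x,x′}·M_h·T`**: if `supp h ⊂ S` (blocks) and `h(x′) ≠ 0 ⇒ y(x) ∈ S`, then `P_{x,x′}·M_h·T` produces outputs over `S` only
(its only output is at `x`, and it vanishes unless `h(x) ≠ 0` or `h(x′) ≠ 0`). [cite: Balaban1984PropagatorsII, (2.92)–(2.93) p.239 (supp h_□ ⊂ □̃); bookkeeping ours] -/
theorem outLoc_pair_mulOp (blk : X → g.Site) (x x' : X) (T : Module.End ℝ (X → ℝ)) {h : X → ℝ} {S : Set g.Site}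
    (hsupp : ∀ z, h z ≠ 0 → blk z ∈ S) (hplace : h x' ≠ 0 → blk x ∈ S) :
    OutLoc blk (pairOp x x' * mulOp h * T) S := by
  intro v z hz
  rw [mul_assoc, pairOp_mul_apply]
  by_cases hzx : z = x
  · rw [if_pos hzx]
    simp only [Module.End.mul_apply, mulOp_apply]
    rw [hzx] at hz
    have hx0 : h x = 0 := by
      by_contra hne
      exact hz (hsupp x hne)
    have hx'0 : h x' = 0 := by
      by_contra hne
      exact hz (hplace hne)
    rw [hx0, hx'0, zero_mul, zero_mul, sub_zero]
  · rw [if_neg hzx]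

omit [DecidableEq X] in
/-- monotonicity of output localisation in the set. [folklore] -/
private theorem outLoc_mono (blk : X → g.Site) {T : Module.End ℝ (X → ℝ)} {S U : Set g.Site} (h : OutLoc blk T S) (hSU : S ⊆ U) :
    OutLoc blk T U := fun v z hz => h v z fun hzS => hz (hSU hzS)

end Generic

/-! ## §2  The V1 torus: the legs of `P_{x,x′}·h_□G_□` and the first leg `P_{x,x′}·(h_□G_□h_□)·∇*_ν`, per cube, from the pair inputs -/

section Cube

variable {d ℓ : ℕ} {hd : 1 ≤ d + 1} {hL : Odd (ℓ + 1) ∧ 1 < ℓ + 1} {a₀ a₁ : ℝ} {m K : ℕ} {Mh k R : ℕ} {P' : Fin (d + 1) → ℕ}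

/-- rate monotonicity of the exponential kernel. [folklore] -/
private theorem exp_le_exp_of_rate {ρ σ t : ℝ} (h : σ ≤ ρ) (ht : 0 ≤ t) : Real.exp (-(ρ * t)) ≤ Real.exp (-(σ * t)) :=
  Real.exp_le_exp.mpr (neg_le_neg (mul_le_mul_of_nonneg_right h ht))

/-- **(L1) THE LEFT FACTOR `P_{x,x′}·h_□G_□` HAS A GLOBAL MAJORANT FROM THE PAIR INPUT** (`L ≥ 5`): there are `ρ₀ > 0`, `C₀ ≥ 0` (on `d, L` and the
weight band) such that on every admissible V1 torus (`M_h = Lᵃ ≥ 2`, `R ≥ 2L²`, placed cube), for every `c′`, weights, global pair `(x, x′)` with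
`|h_□(x) − h_□(x′)| ≤ σ_h`, the PLACEMENT `h_□(x′) ≠ 0 ⇒ y(x) ∈ □⁺`, and — when `h_□(x) ≠ 0` or `h_□(x′) ≠ 0` — the pair input
`OutMajorant (P_{x,x′}·G_□) (□⁺) (τ·pref·e^{−ρ′d})`: `HasMajorant (P_{x,x′}·h_□G_□) ((τ + σ_h·C₀)·pref·e^{−min(ρ₀,ρ′)d_T})` — inputs anywhere (p22's
`hGout_cube` for the single-point part). [cite: Balaban1984PropagatorsII, (2.134) line 1 & (2.137) p.247, (2.92)/(2.95) p.239; Balaban1984PropagatorsI, (1.109) p.35] -/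
theorem legHG_pair_of_inputs (d ℓ : ℕ) (hd : 1 ≤ d + 1) (hL : Odd (ℓ + 1) ∧ 1 < ℓ + 1) {a₀ a₁ : ℝ} (ha₀ : 0 < a₀) (ha₁ : a₀ ≤ a₁) :
    ∃ ρ₀ : ℝ, 0 < ρ₀ ∧ ∃ C₀ : ℝ, 0 ≤ C₀ ∧ ∀ (m K : ℕ) {Mh k R : ℕ} {P' : Fin (d + 1) → ℕ}
      (hN : ∀ μ, N0 ℓ Mh k P' μ = (PV d ℓ m K hd hL).sitesPerDir 0) (D : TDomains d ℓ Mh k P' R) (hk : k ≤ m + K)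
      (hMh1 : 1 ≤ Mh) (hP4 : ∀ μ, 4 ≤ P' μ) {a : ℕ} (hMha : Mh = (ℓ + 1) ^ a) (_ : 2 ≤ Mh) (_ : 2 * (ℓ + 1) ^ 2 ≤ R) (_ : 4 ≤ ℓ)
      (c : ↥(cubes D.toDomains)) (hpl : Placed ℓ k P' c.1) (w : BondIdx (domT hN D hk) → ℝ) (cf : ℝ)
      (x x' : PBond (PV d ℓ m K hd hL) 0) {sH : ℝ}, 0 ≤ sH → |hB hN D c x - hB hN D c x'| ≤ sH →
      (hB hN D c x' ≠ 0 → blkV1 hN D x ∈ ST D hMh1 hP4 c) →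
      ∀ (τ ρ' : ℝ), 0 ≤ τ → 0 < ρ' →
      (hB hN D c x ≠ 0 ∨ hB hN D c x' ≠ 0 → OutMajorant (g := geomT D) (blkV1 hN D)
        (pairOp x x' * Gl hN hk hMh1 hP4 hMha c ha₁ hpl w cf) (ST D hMh1 hP4 c)
        (fun y y'' => τ * pref cf y * Real.exp (-(ρ' * (geomT D).dist y y'')))) →
      HasMajorant (g := geomT D) (blkV1 hN D) (pairOp x x' * mulOp (hB hN D c) * Gl hN hk hMh1 hP4 hMha c ha₁ hpl w cf)
        (fun y y'' => (τ + sH * C₀) * pref cf y * Real.exp (-(min ρ₀ ρ' * (geomT D).dist y y''))) := by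
  obtain ⟨ρG, hρG, CG, hCG, hGout⟩ := hGout_cube d ℓ hd hL ha₀ ha₁
  refine ⟨ρG, hρG, CG, hCG, ?_⟩
  intro m K Mh k R P' hN D hk hMh1 hP4 a hMha hMh hR2 hℓ c hpl w cf x x' sH hsH hLip hplace τ ρ' hτ hρ' hpair
  have hR : 2 * (ℓ + 1) ≤ R := le_trans (by nlinarith : 2 * (ℓ + 1) ≤ 2 * (ℓ + 1) ^ 2) hR2
  have hP : ∀ μ, 1 ≤ P' μ := one_le_of_four_le hP4
  obtain ⟨-, -, hdnn⟩ := triangle_refl_nonneg_T D hMh1 hP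
  have hout := hGout m K hN D hk hMh1 hP4 hMha hMh hR2 hℓ c hpl w cf
  have hmain := hasMajorant_pair_mulOp_of_out (g := geomT D) (blkV1 hN D) x x' (S := ST D hMh1 hP4 c)
    (K := fun y y'' => τ * pref cf y * Real.exp (-(ρ' * (geomT D).dist y y'')))
    (K₁ := fun y y'' => CG * pref cf y * Real.exp (-(ρG * (geomT D).dist y y'')))
    (fun y y'' => by have := pref_nonneg cf y; positivity) (fun y y'' => by have := pref_nonneg cf y; positivity) hsH hpair hout
    (fun b hb => (mem_ST D hMh1 hP4 c _).2 (blkV1_mem_QT_of_hB_ne_zero hN D hMh hR hP4 c hb))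
    (fun b => abs_hB_le_one hN D hMh1 hP c b) hLip hplace
  refine hasMajorant_mono _ hmain fun y y'' => ?_
  have hp := pref_nonneg cf y
  have hd0 := hdnn y y''
  have e1 := exp_le_exp_of_rate (min_le_right ρG ρ') hd0
  have e2 := exp_le_exp_of_rate (min_le_left ρG ρ') hd0
  have i1 := ind_le_one (ST D hMh1 hP4 c) y
  have i1' := ind_nonneg (ST D hMh1 hP4 c) y
  set E := Real.exp (-(min ρG ρ' * (geomT D).dist y y'')) with hE
  have hEnn : 0 ≤ E := Real.exp_nonneg _
  calc ind (ST D hMh1 hP4 c) y * (τ * pref cf y * Real.exp (-(ρ' * (geomT D).dist y y'')) +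
          sH * (CG * pref cf y * Real.exp (-(ρG * (geomT D).dist y y''))))
      ≤ 1 * (τ * pref cf y * E + sH * (CG * pref cf y * E)) := by
        gcongr
    _ = (τ + sH * CG) * pref cf y * E := by ring

/-- **(L2) THE RIGHT LEGS `P_{x,x′}·h_□G_□·E_e` HAVE GLOBAL MAJORANTS FROM THE PAIR INPUTS** (all `2(d+1)` legs `e`, one `(ρ₀, C₀)`): with the pair input
`OutMajorant (P_{x,x′}·(G_□·E_e)) (□⁺) (τ_e·pref·e^{−ρ′d})` (when `h_□(x) ≠ 0` or `h_□(x′) ≠ 0`), the placement `h_□(x′) ≠ 0 ⇒ y(x) ∈ □⁺` and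
`|h_□(x) − h_□(x′)| ≤ σ_h`: `HasMajorant (P_{x,x′}·h_□G_□·E_e) ((τ_e + σ_h·C₀)·pref·e^{−min(ρ₀,ρ′)d_T})` (this seat's `hGEout_cube` for the single-point part).
[cite: Balaban1984PropagatorsII, (2.92)–(2.95) p.239, (2.134)/(2.137) p.247; Balaban1984PropagatorsI, (1.109) p.35] -/
theorem legHGE_pair_of_inputs (d ℓ : ℕ) (hd : 1 ≤ d + 1) (hL : Odd (ℓ + 1) ∧ 1 < ℓ + 1) {a₀ a₁ : ℝ} (ha₀ : 0 < a₀) (ha₁ : a₀ ≤ a₁) :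
    ∃ ρ₀ : ℝ, 0 < ρ₀ ∧ ∃ C₀ : ℝ, 0 ≤ C₀ ∧ ∀ (m K : ℕ) {Mh k R : ℕ} {P' : Fin (d + 1) → ℕ}
      (hN : ∀ μ, N0 ℓ Mh k P' μ = (PV d ℓ m K hd hL).sitesPerDir 0) (D : TDomains d ℓ Mh k P' R) (hk : k ≤ m + K)
      (hMh1 : 1 ≤ Mh) (hP4 : ∀ μ, 4 ≤ P' μ) {a : ℕ} (hMha : Mh = (ℓ + 1) ^ a) (_ : 2 ≤ Mh) (_ : 2 * (ℓ + 1) ^ 2 ≤ R) (_ : 4 ≤ ℓ)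
      (c : ↥(cubes D.toDomains)) (hpl : Placed ℓ k P' c.1) (w : BondIdx (domT hN D hk) → ℝ) (cf : ℝ) (e : Fin (d + 1) × Bool)
      (x x' : PBond (PV d ℓ m K hd hL) 0) {sH : ℝ}, 0 ≤ sH → |hB hN D c x - hB hN D c x'| ≤ sH →
      (hB hN D c x' ≠ 0 → blkV1 hN D x ∈ ST D hMh1 hP4 c) →
      ∀ (τ ρ' : ℝ), 0 ≤ τ → 0 < ρ' →
      (hB hN D c x ≠ 0 ∨ hB hN D c x' ≠ 0 → OutMajorant (g := geomT D) (blkV1 hN D)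
        (pairOp x x' * (Gl hN hk hMh1 hP4 hMha c ha₁ hpl w cf * EC hN hk hMh1 hP4 hMha c ha₁ hpl w cf e)) (ST D hMh1 hP4 c)
        (fun y y'' => τ * pref cf y * Real.exp (-(ρ' * (geomT D).dist y y'')))) →
      HasMajorant (g := geomT D) (blkV1 hN D)
        (pairOp x x' * mulOp (hB hN D c) * Gl hN hk hMh1 hP4 hMha c ha₁ hpl w cf * EC hN hk hMh1 hP4 hMha c ha₁ hpl w cf e)
        (fun y y'' => (τ + sH * C₀) * pref cf y * Real.exp (-(min ρ₀ ρ' * (geomT D).dist y y''))) := by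
  obtain ⟨ρE, hρE, CE, hCE, hGEout⟩ := hGEout_cube d ℓ hd hL ha₀ ha₁
  refine ⟨ρE, hρE, CE, hCE, ?_⟩
  intro m K Mh k R P' hN D hk hMh1 hP4 a hMha hMh hR2 hℓ c hpl w cf e x x' sH hsH hLip hplace τ ρ' hτ hρ' hpair
  have hR : 2 * (ℓ + 1) ≤ R := le_trans (by nlinarith : 2 * (ℓ + 1) ≤ 2 * (ℓ + 1) ^ 2) hR2
  have hP : ∀ μ, 1 ≤ P' μ := one_le_of_four_le hP4
  obtain ⟨-, -, hdnn⟩ := triangle_refl_nonneg_T D hMh1 hP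
  have hout := hGEout m K hN D hk hMh1 hP4 hMha hMh hR2 hℓ c hpl w cf e
  have hmain := hasMajorant_pair_mulOp_of_out (g := geomT D) (blkV1 hN D) x x' (S := ST D hMh1 hP4 c)
    (T := Gl hN hk hMh1 hP4 hMha c ha₁ hpl w cf * EC hN hk hMh1 hP4 hMha c ha₁ hpl w cf e)
    (K := fun y y'' => τ * pref cf y * Real.exp (-(ρ' * (geomT D).dist y y'')))
    (K₁ := fun y y'' => CE * pref cf y * Real.exp (-(ρE * (geomT D).dist y y'')))
    (fun y y'' => by have := pref_nonneg cf y; positivity) (fun y y'' => by have := pref_nonneg cf y; positivity) hsH hpair hout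
    (fun b hb => (mem_ST D hMh1 hP4 c _).2 (blkV1_mem_QT_of_hB_ne_zero hN D hMh hR hP4 c hb))
    (fun b => abs_hB_le_one hN D hMh1 hP c b) hLip hplace
  rw [← mul_assoc] at hmain
  refine hasMajorant_mono _ hmain fun y y'' => ?_
  have hp := pref_nonneg cf y
  have hd0 := hdnn y y''
  have e1 := exp_le_exp_of_rate (min_le_right ρE ρ') hd0
  have e2 := exp_le_exp_of_rate (min_le_left ρE ρ') hd0
  have i1 := ind_le_one (ST D hMh1 hP4 c) y
  have i1' := ind_nonneg (ST D hMh1 hP4 c) y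
  set E := Real.exp (-(min ρE ρ' * (geomT D).dist y y'')) with hE
  have hEnn : 0 ≤ E := Real.exp_nonneg _
  calc ind (ST D hMh1 hP4 c) y * (τ * pref cf y * Real.exp (-(ρ' * (geomT D).dist y y'')) +
          sH * (CE * pref cf y * Real.exp (-(ρE * (geomT D).dist y y''))))
      ≤ 1 * (τ * pref cf y * E + sH * (CE * pref cf y * E)) := by
        gcongr
    _ = (τ + sH * CE) * pref cf y * E := by ring

/-- **(L3) THE LEFT FACTOR `P_{x,x′}·h_□G_□` PRODUCES OUTPUTS OVER `□⁺ ⊆ □̃` ONLY**, given the placement `h_□(x′) ≠ 0 ⇒ y(x) ∈ □⁺` of the pair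
(`supp h_□ ⊂ □⁺ ⊆ □̃`). [cite: Balaban1984PropagatorsII, (2.91)–(2.93) p.239 (supp h_□ ⊂ □̃), (2.134) p.247] -/
theorem outLoc_pairLeg (hN : ∀ μ, N0 ℓ Mh k P' μ = (PV d ℓ m K hd hL).sitesPerDir 0) {D : TDomains d ℓ Mh k P' R} (hk : k ≤ m + K)
    (hMh1 : 1 ≤ Mh) (hP4 : ∀ μ, 4 ≤ P' μ) {a : ℕ} (hMha : Mh = (ℓ + 1) ^ a) (hMh : 2 ≤ Mh) (hR : 2 * (ℓ + 1) ≤ R)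
    (c : ↥(cubes D.toDomains)) (ha₁ : a₀ ≤ a₁) (hpl : Placed ℓ k P' c.1) (w : BondIdx (domT hN D hk) → ℝ) (cf : ℝ)
    (x x' : PBond (PV d ℓ m K hd hL) 0) (hplace : hB hN D c x' ≠ 0 → blkV1 hN D x ∈ ST D hMh1 hP4 c) :
    OutLoc (g := geomT D) (blkV1 hN D) (pairOp x x' * mulOp (hB hN D c) * Gl hN hk hMh1 hP4 hMha c ha₁ hpl w cf) (SbigT D hMh1 hP4 c) :=
  outLoc_mono (g := geomT D) (blkV1 hN D)
    (outLoc_pair_mulOp (g := geomT D) (blkV1 hN D) x x' _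
      (fun _ hb => (mem_ST D hMh1 hP4 c _).2 (blkV1_mem_QT_of_hB_ne_zero hN D hMh hR hP4 c hb)) hplace)
    (ST_subset_SbigT D hMh1 hP4 c)

set_option maxHeartbeats 800000 in
/-- **(F1) THE FIRST LEG OF THE TWO-SIDED WALK, `P_{x,x′}·(h_□G_□h_□)·∇*_ν`, PER CUBE, FROM THE PAIR INPUTS** (`L ≥ 5`): there are `ρ₀ > 0`, `C₀ ≥ 0`
(on `d, L` and the weight band) such that on every admissible V1 torus (`M_h = Lᵃ ≥ 8`, `R ≥ 2L²`, `P′ ≥ 5`, placed cube), for every `c′ ≠ 0`, weights,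
direction `ν`, global pair `(x, x′)` with `|h_□(x) − h_□(x′)| ≤ σ_h`, the placement `h_□(x′) ≠ 0 ⇒ y(x) ∈ □⁺`, and — when `h_□(x) ≠ 0` or
`h_□(x′) ≠ 0` — the two pair inputs `OutMajorant (P_{x,x′}·(G_□·E_(ν,−))) (□⁺) (τ_E·pref·e^{−ρ′d})`, `OutMajorant (P_{x,x′}·G_□) (□⁺) (τ·pref·e^{−ρ′d})`:
`HasMajorant (P_{x,x′}·(h_□G_□h_□)·∇*_ν) (1_{□⁺}(y)·L²(τ_E + C1F·τ + σ_h·C₀)·(L^{j(y)}|c′|⁻¹)·e^{−min(ρ₀,ρ′)d_T(y,y′)})` — print's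
`O(1)(Lʲη)^{1−α}|x − x′|^α e^{−δd}|J|` for the first leg once `τ_E = C_H t^α`, `τ = C_H t`, `σ_h = C t` (p38's `GDVa_sandwich_eq`:
`(h_□G_□h_□)∇*_ν = (c′/L^{j₀})·h_□(G_□E_(ν,−))(S_νh_□) + h_□G_□(∇_νh_□)`).
[cite: Balaban1984PropagatorsII, Prop. 2.6 (2.137) p.247, (2.141) p.247 (first leg), (2.133) p.247, (2.92) p.239 (line 1); Balaban1984PropagatorsI, (1.109) p.35] -/
theorem firstLegDiv_pair_of_inputs (d ℓ : ℕ) (hd : 1 ≤ d + 1) (hL : Odd (ℓ + 1) ∧ 1 < ℓ + 1) {a₀ a₁ : ℝ} (ha₀ : 0 < a₀) (ha₁ : a₀ ≤ a₁) :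
    ∃ ρ₀ : ℝ, 0 < ρ₀ ∧ ∃ C₀ : ℝ, 0 ≤ C₀ ∧ ∀ (m K : ℕ) {Mh k R : ℕ} {P' : Fin (d + 1) → ℕ}
      (hN : ∀ μ, N0 ℓ Mh k P' μ = (PV d ℓ m K hd hL).sitesPerDir 0) (D : TDomains d ℓ Mh k P' R) (hk : k ≤ m + K)
      (hMh1 : 1 ≤ Mh) (hP4 : ∀ μ, 4 ≤ P' μ) {a : ℕ} (hMha : Mh = (ℓ + 1) ^ a) (_ : 8 ≤ Mh) (_ : 2 * (ℓ + 1) ^ 2 ≤ R) (_ : ∀ μ, 5 ≤ P' μ)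
      (_ : 4 ≤ ℓ) (c : ↥(cubes D.toDomains)) (hpl : Placed ℓ k P' c.1) (w : BondIdx (domT hN D hk) → ℝ) {cf : ℝ} (_ : cf ≠ 0) (ν : Fin (d + 1))
      (x x' : PBond (PV d ℓ m K hd hL) 0) {sH : ℝ}, 0 ≤ sH → |hB hN D c x - hB hN D c x'| ≤ sH →
      (hB hN D c x' ≠ 0 → blkV1 hN D x ∈ ST D hMh1 hP4 c) →
      ∀ (τE τ ρ' : ℝ), 0 ≤ τE → 0 ≤ τ → 0 < ρ' →
      (hB hN D c x ≠ 0 ∨ hB hN D c x' ≠ 0 → OutMajorant (g := geomT D) (blkV1 hN D)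
        (pairOp x x' * (Gl hN hk hMh1 hP4 hMha c ha₁ hpl w cf * EC hN hk hMh1 hP4 hMha c ha₁ hpl w cf (ν, false))) (ST D hMh1 hP4 c)
        (fun y y' => τE * pref cf y * Real.exp (-(ρ' * (geomT D).dist y y')))) →
      (hB hN D c x ≠ 0 ∨ hB hN D c x' ≠ 0 → OutMajorant (g := geomT D) (blkV1 hN D)
        (pairOp x x' * Gl hN hk hMh1 hP4 hMha c ha₁ hpl w cf) (ST D hMh1 hP4 c)
        (fun y y' => τ * pref cf y * Real.exp (-(ρ' * (geomT D).dist y y')))) →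
      HasMajorant (g := geomT D) (blkV1 hN D)
        (pairOp x x' * (mulOp (hB hN D c) * Gl hN hk hMh1 hP4 hMha c ha₁ hpl w cf * mulOp (hB hN D c)) * DVa ν cf)
        (fun y y' => ind (ST D hMh1 hP4 c) y *
          ((((ℓ + 1 : ℕ) : ℝ)) ^ 2 * (τE + C1F d ℓ * τ + sH * C₀) * ((geomT D).len y * |cf|⁻¹) *
            Real.exp (-(min ρ₀ ρ' * (geomT D).dist y y')))) := by
  obtain ⟨ρG, hρG, CG, hCG, hGout⟩ := hGout_cube d ℓ hd hL ha₀ ha₁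
  obtain ⟨ρE, hρE, CE, hCE, hGEout⟩ := hGEout_cube d ℓ hd hL ha₀ ha₁
  have hC1 := C1F_nonneg d ℓ
  refine ⟨min ρE ρG, lt_min hρE hρG, CE + C1F d ℓ * CG, by positivity, ?_⟩
  intro m K Mh k R P' hN D hk hMh1 hP4 a hMha hM8 hR2 hP5 hℓ c hpl w cf hcf ν x x' sH hsH hLip hplace τE τ ρ' hτE hτ hρ' hpairE hpair
  have hMh : 2 ≤ Mh := le_trans (by norm_num) hM8
  have hR : 2 * (ℓ + 1) ≤ R := le_trans (by nlinarith : 2 * (ℓ + 1) ≤ 2 * (ℓ + 1) ^ 2) hR2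
  have hP : ∀ μ, 1 ≤ P' μ := one_le_of_four_le hP4
  obtain ⟨-, -, hdnn⟩ := triangle_refl_nonneg_T D hMh1 hP
  -- abbreviations: the scale `s = c′/L^{j₀}`, the size `t_D` of `∇_νh_□`, `L²`
  have hJ0 : (0 : ℝ) < (((ℓ + 1 : ℕ) : ℝ)) ^ j0 hMh1 hP4 c := by positivity
  obtain ⟨s, hs⟩ : ∃ s : ℝ, cf / (((ℓ + 1 : ℕ) : ℝ)) ^ j0 hMh1 hP4 c = s := ⟨_, rfl⟩
  have habs : |cf| / (((ℓ + 1 : ℕ) : ℝ)) ^ j0 hMh1 hP4 c = |s| := by rw [← hs, abs_div, abs_of_pos hJ0]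
  obtain ⟨tD, htD⟩ : ∃ t : ℝ, |cf| * (C1F d ℓ / (8 / 5 * (bigSide ℓ Mh c.1.1 : ℝ))) = t := ⟨_, rfl⟩
  have htD0 : 0 ≤ tD := by rw [← htD]; have := one_le_bigSide hMh1 (ℓ := ℓ) c.1.1; positivity
  obtain ⟨L2, hL2⟩ : ∃ t : ℝ, (((ℓ + 1 : ℕ) : ℝ)) ^ 2 = t := ⟨_, rfl⟩
  have hL20 : 0 ≤ L2 := by rw [← hL2]; positivity
  -- support and sizes of `h_□`, `S_νh_□`, `∇_νh_□`
  have hsupp : ∀ b : PBond (PV d ℓ m K hd hL) 0, hB hN D c b ≠ 0 → blkV1 hN D b ∈ ST D hMh1 hP4 c :=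
    fun b hb => (mem_ST D hMh1 hP4 c _).2 (blkV1_mem_QT_of_hB_ne_zero hN D hMh hR hP4 c hb)
  have hle1 : ∀ b : PBond (PV d ℓ m K hd hL) 0, |hB hN D c b| ≤ 1 := fun b => abs_hB_le_one hN D hMh1 hP c b
  have hsh1 : ∀ b : PBond (PV d ℓ m K hd hL) 0, |shB ν (hB hN D c) b| ≤ 1 := fun b => by rw [shB_apply]; exact hle1 _
  have hDV : ∀ b : PBond (PV d ℓ m K hd hL) 0, |DV ν cf (hB hN D c) b| ≤ tD := fun b => by
    rw [abs_DV_apply, ← htD]; exact mul_le_mul_of_nonneg_left (abs_hB_shift_sub_le hN c hMh hR hP5 ν b) (abs_nonneg _)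
  -- the single-point output-localised legs, weakened to the common rate `ρ₀ = min ρE ρG`
  have houtG : OutMajorant (g := geomT D) (blkV1 hN D) (Gl hN hk hMh1 hP4 hMha c ha₁ hpl w cf) (ST D hMh1 hP4 c)
      (fun y y' => CG * pref cf y * Real.exp (-(min ρE ρG * (geomT D).dist y y'))) :=
    outMajorant_mono _ (hGout m K hN D hk hMh1 hP4 hMha hMh hR2 hℓ c hpl w cf) fun y _ y' =>
      mul_le_mul_of_nonneg_left (exp_le_exp_of_rate (min_le_right _ _) (hdnn y y')) (by have := pref_nonneg cf y; positivity)
  have houtE : OutMajorant (g := geomT D) (blkV1 hN D)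
      (Gl hN hk hMh1 hP4 hMha c ha₁ hpl w cf * EC hN hk hMh1 hP4 hMha c ha₁ hpl w cf (ν, false)) (ST D hMh1 hP4 c)
      (fun y y' => CE * pref cf y * Real.exp (-(min ρE ρG * (geomT D).dist y y'))) :=
    outMajorant_mono _ (hGEout m K hN D hk hMh1 hP4 hMha hMh hR2 hℓ c hpl w cf (ν, false)) fun y _ y' =>
      mul_le_mul_of_nonneg_left (exp_le_exp_of_rate (min_le_left _ _) (hdnn y y')) (by have := pref_nonneg cf y; positivity)
  -- TERM A: `s•(P·h·(G_□E)·(S_νh))` — pair and single inputs with the right factor `S_νh_□` (`|·| ≤ 1`), scaled by `s`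
  have hpairA : hB hN D c x ≠ 0 ∨ hB hN D c x' ≠ 0 → OutMajorant (g := geomT D) (blkV1 hN D)
      (pairOp x x' * (s • (Gl hN hk hMh1 hP4 hMha c ha₁ hpl w cf * EC hN hk hMh1 hP4 hMha c ha₁ hpl w cf (ν, false) *
        mulOp (shB ν (hB hN D c)))))
      (ST D hMh1 hP4 c) (fun y y' => |s| * (1 * (τE * pref cf y * Real.exp (-(ρ' * (geomT D).dist y y'))))) := by
    intro hne
    have h1 := outMajorant_mul_mulOp_bdd (g := geomT D) (blkV1 hN D) (hpairE hne) zero_le_one hsh1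
    rw [mul_assoc] at h1
    have h2 := B6InDecayWindowV1.outMajorant_smul (g := geomT D) (blkV1 hN D) h1 s
    rwa [← mul_smul_comm] at h2
  have houtA : OutMajorant (g := geomT D) (blkV1 hN D)
      (s • (Gl hN hk hMh1 hP4 hMha c ha₁ hpl w cf * EC hN hk hMh1 hP4 hMha c ha₁ hpl w cf (ν, false) * mulOp (shB ν (hB hN D c))))
      (ST D hMh1 hP4 c) (fun y y' => |s| * (1 * (CE * pref cf y * Real.exp (-(min ρE ρG * (geomT D).dist y y'))))) :=
    B6InDecayWindowV1.outMajorant_smul (g := geomT D) (blkV1 hN D)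
      (outMajorant_mul_mulOp_bdd (g := geomT D) (blkV1 hN D) houtE zero_le_one hsh1) s
  have hTA := hasMajorant_pair_mulOp_of_out (g := geomT D) (blkV1 hN D) x x' (S := ST D hMh1 hP4 c)
    (fun y y' => by have := pref_nonneg cf y; positivity) (fun y y' => by have := pref_nonneg cf y; positivity)
    hsH hpairA houtA hsupp hle1 hLip hplace
  -- TERM B: `P·h·G_□·(∇_νh_□)` — pair and single inputs with the right factor `∇_νh_□` (`|·| ≤ t_D`)
  have hpairB : hB hN D c x ≠ 0 ∨ hB hN D c x' ≠ 0 → OutMajorant (g := geomT D) (blkV1 hN D)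
      (pairOp x x' * (Gl hN hk hMh1 hP4 hMha c ha₁ hpl w cf * mulOp (DV ν cf (hB hN D c)))) (ST D hMh1 hP4 c)
      (fun y y' => tD * (τ * pref cf y * Real.exp (-(ρ' * (geomT D).dist y y')))) := by
    intro hne
    have h1 := outMajorant_mul_mulOp_bdd (g := geomT D) (blkV1 hN D) (hpair hne) htD0 hDV
    rwa [mul_assoc] at h1
  have houtB : OutMajorant (g := geomT D) (blkV1 hN D) (Gl hN hk hMh1 hP4 hMha c ha₁ hpl w cf * mulOp (DV ν cf (hB hN D c)))
      (ST D hMh1 hP4 c) (fun y y' => tD * (CG * pref cf y * Real.exp (-(min ρE ρG * (geomT D).dist y y')))) :=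
    outMajorant_mul_mulOp_bdd (g := geomT D) (blkV1 hN D) houtG htD0 hDV
  have hTB := hasMajorant_pair_mulOp_of_out (g := geomT D) (blkV1 hN D) x x' (S := ST D hMh1 hP4 c)
    (fun y y' => by have := pref_nonneg cf y; positivity) (fun y y' => by have := pref_nonneg cf y; positivity)
    hsH hpairB houtB hsupp hle1 hLip hplace
  -- the operator identity `P·(hGh)·∇* = s•(P·h·((G E)(S h))) + P·h·(G(∇h))` and the sum of the two majorants
  have e : pairOp x x' * (mulOp (hB hN D c) * Gl hN hk hMh1 hP4 hMha c ha₁ hpl w cf * mulOp (hB hN D c)) * DVa ν cf =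
      s • (pairOp x x' * mulOp (hB hN D c) *
          (Gl hN hk hMh1 hP4 hMha c ha₁ hpl w cf * EC hN hk hMh1 hP4 hMha c ha₁ hpl w cf (ν, false) * mulOp (shB ν (hB hN D c)))) +
        pairOp x x' * mulOp (hB hN D c) * (Gl hN hk hMh1 hP4 hMha c ha₁ hpl w cf * mulOp (DV ν cf (hB hN D c))) := by
    rw [mul_assoc (pairOp x x'), GDVa_sandwich_eq hN hk hMh1 hP4 hMha c ha₁ ha₀ hM8 hR2 hpl w hcf ν, hs, mul_add, mul_smul_comm]
    simp only [mul_assoc]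
  rw [mul_smul_comm] at hTA
  rw [e]
  refine hasMajorant_mono _ (hasMajorant_add _ hTA hTB) fun y y' => ?_
  -- pointwise comparison of the kernels
  have hp := pref_nonneg cf y
  have hd0 := hdnn y y'
  have hl0 : 0 ≤ (geomT D).len y * |cf|⁻¹ := by rw [geomT_len]; positivity
  have eρ' := exp_le_exp_of_rate (min_le_right (min ρE ρG) ρ') hd0
  have eρ₀ := exp_le_exp_of_rate (min_le_left (min ρE ρG) ρ') hd0
  set E := Real.exp (-(min (min ρE ρG) ρ' * (geomT D).dist y y')) with hEdef
  have hEnn : 0 ≤ E := Real.exp_nonneg _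
  have iS' := ind_nonneg (ST D hMh1 hP4 c) y
  have hSpart : ind (ST D hMh1 hP4 c) y * (|s| * (1 * (τE * pref cf y * Real.exp (-(ρ' * (geomT D).dist y y')))) +
        sH * (|s| * (1 * (CE * pref cf y * Real.exp (-(min ρE ρG * (geomT D).dist y y')))))) +
      ind (ST D hMh1 hP4 c) y * (tD * (τ * pref cf y * Real.exp (-(ρ' * (geomT D).dist y y'))) +
        sH * (tD * (CG * pref cf y * Real.exp (-(min ρE ρG * (geomT D).dist y y'))))) ≤
      ind (ST D hMh1 hP4 c) y * (L2 * (τE + sH * CE + C1F d ℓ * τ + sH * (C1F d ℓ * CG)) * ((geomT D).len y * |cf|⁻¹) * E) := by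
    by_cases hy : y ∈ ST D hMh1 hP4 c
    · have hps := pref_scale_le hL hMh1 hP4 c hR2 hcf hy
      rw [habs, hL2] at hps
      have hls := lip_scale_le hL hMh1 hP4 c hR2 hcf hy
      rw [htD, hL2] at hls
      rw [ind_of_mem hy]
      simp only [one_mul]
      calc |s| * (τE * pref cf y * Real.exp (-(ρ' * (geomT D).dist y y'))) +
            sH * (|s| * (CE * pref cf y * Real.exp (-(min ρE ρG * (geomT D).dist y y')))) +
            (tD * (τ * pref cf y * Real.exp (-(ρ' * (geomT D).dist y y'))) +
              sH * (tD * (CG * pref cf y * Real.exp (-(min ρE ρG * (geomT D).dist y y')))))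
          = τE * (|s| * pref cf y) * Real.exp (-(ρ' * (geomT D).dist y y')) +
              sH * CE * (|s| * pref cf y) * Real.exp (-(min ρE ρG * (geomT D).dist y y')) +
            (τ * (tD * pref cf y) * Real.exp (-(ρ' * (geomT D).dist y y')) +
              sH * CG * (tD * pref cf y) * Real.exp (-(min ρE ρG * (geomT D).dist y y'))) := by ring
        _ ≤ τE * (L2 * ((geomT D).len y * |cf|⁻¹)) * E + sH * CE * (L2 * ((geomT D).len y * |cf|⁻¹)) * E +
            (τ * (L2 * C1F d ℓ * ((geomT D).len y * |cf|⁻¹)) * E + sH * CG * (L2 * C1F d ℓ * ((geomT D).len y * |cf|⁻¹)) * E) := by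
            gcongr
        _ = L2 * (τE + sH * CE + C1F d ℓ * τ + sH * (C1F d ℓ * CG)) * ((geomT D).len y * |cf|⁻¹) * E := by ring
    · rw [ind_of_not_mem hy]
      norm_num
  rw [hL2]
  refine le_trans (le_of_eq ?_) (hSpart.trans (le_of_eq ?_))
  · ring
  · ring

end Cube

end Literature.MathematicalPhysics.QuantumFieldTheory.Balaban1983to89.B6HolderDivLegPairTermsV1

end
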